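import Summits.SmoothPoincare4.SmoothPoincare4.Theorems.SullivanDualWitnessChargeV15CapModelACS

/-!
# Cap model for crux `WitnessCharge`, III-b: smoothness of the almost complex structure

Sequel to `…V15CapModelACS.lean` (stub `stub_capModel` of skeleton v15, line `Sketch`, lead c8).
`capJ` is a smooth section of `End(TX)`: at `inl a₀` its tangent-coordinate expression equals
that of `J` at `a₀` (the preferred charts of `X` at points of `Σ ∖ p` are the charts of `Σ ∖ p`,
so the chart transitions coincide), and at a point of the added line it is the CONSTANT `flatI`
on the cap chart domain (conjugating `capJ = d(capInv) ∘ i ∘ d(capInv)⁻¹` by the differential of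
the extended chart `flatCx.symm ∘ capCoord`). Hence `exists_capJX`.
-/

noncomputable section

set_option linter.dupNamespace false

open scoped Manifold ContDiff Topology
open Set Filter Function Literature.Geometry.Symplectic Literature.Topology.FourManifolds
  TopologicalSpace Bundle

namespace Summit.SmoothPoincare4.SmoothPoincare4.Theorems.WitnessCharge.PencilIncompleteness

variable {S : HomotopySphere 4} {p : S.carrier} {ε' : ℝ}
variable (hε' : 0 < ε')
  (hball : Metric.closedBall (extChartAt (𝓡 4) p p) ε' ⊆ (extChartAt (𝓡 4) p).target)
  (J : ∀ x : punctured p, TangentSpace (𝓡 4) x →L[ℝ] TangentSpace (𝓡 4) x)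
  (hJ2 : ∀ (x : punctured p) (v : TangentSpace (𝓡 4) x), J x (J x v) = -v)
  (hJstd : ∀ x : punctured p, InPuncturedChartBall p ε' x →
    ∀ (v : TangentSpace (𝓡 4) x) (c : EuclideanSpace ℝ (Fin 4)),
      inner ℝ (fderiv ℝ inversion (extChartAt (𝓡 4) p x.1 - extChartAt (𝓡 4) p p)
        (mfderiv (𝓡 4) 𝓘(ℝ, EuclideanSpace ℝ (Fin 4))
          (fun z : punctured p => extChartAt (𝓡 4) p z.1) x (J x v))) c
      = stdSymplecticForm (fderiv ℝ inversion (extChartAt (𝓡 4) p x.1 - extChartAt (𝓡 4) p p)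
        (mfderiv (𝓡 4) 𝓘(ℝ, EuclideanSpace ℝ (Fin 4))
          (fun z : punctured p => extChartAt (𝓡 4) p z.1) x v)) c)

/-- A two-sided inverse is determined: if `B ∘ A = id` and `A ∘ C = id` then `B = C` (continuous
linear maps of `ℝ⁴`; the shape of the argument identifying the within-derivative of an inverse
extended chart). Registered helper of the crux (stub `stub_capModel`, file III-b). -/
theorem helper_capModel_inverse_unique :
    ∀ A B C : EuclideanSpace ℝ (Fin 4) →L[ℝ] EuclideanSpace ℝ (Fin 4),
      B.comp A = ContinuousLinearMap.id ℝ (EuclideanSpace ℝ (Fin 4)) →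
      A.comp C = ContinuousLinearMap.id ℝ (EuclideanSpace ℝ (Fin 4)) → B = C := by
  intro A B C hBA hAC
  calc B = B.comp (A.comp C) := by rw [hAC, ContinuousLinearMap.comp_id]
    _ = (B.comp A).comp C := by rw [ContinuousLinearMap.comp_assoc]
    _ = C := by rw [hBA, ContinuousLinearMap.id_comp]

/-! ### Smoothness of `capJ` -/

/-- The inverse extended chart of `X` at `inl a`, on all of `ℝ⁴`: `inl ∘ (extChartAt a).symm`. -/
theorem extChartAt_inl_symm_apply (a : punctured p) (v : EuclideanSpace ℝ (Fin 4)) :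
    (extChartAt (𝓡 4) ((capGlueData hε' hball).inl a)).symm v =
      (capGlueData hε' hball).inl ((extChartAt (𝓡 4) a).symm v) := by
  simp only [extChartAt, OpenPartialHomeomorph.extend, PartialEquiv.coe_trans_symm,
    OpenPartialHomeomorph.coe_toPartialEquiv_symm, ModelWithCorners.toPartialEquiv_coe_symm,
    modelWithCornersSelf_coe_symm, comp_apply, id_eq, chartAt_inl, SmoothGlueData.chartA,
    OpenPartialHomeomorph.lift_openEmbedding_symm, OpenPartialHomeomorph.transHomeomorph_symm_apply,
    SmoothGlueData.modelHomeoA_symm_apply, capGlueData_linA, ContinuousLinearEquiv.refl_symm,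
    ContinuousLinearEquiv.refl_apply]

variable (hJsmooth : ∀ x₀ : punctured p,
    ContMDiffAt (𝓡 4) 𝓘(ℝ, EuclideanSpace ℝ (Fin 4) →L[ℝ] EuclideanSpace ℝ (Fin 4)) ∞
      (inTangentCoordinates (𝓡 4) (𝓡 4) (id : punctured p → punctured p) id (fun x => J x) x₀) x₀)

/-- **At points of `Σ ∖ p`, the tangent-coordinate expression of `capJ` is that of `J`.** -/
theorem inTangentCoordinates_capJ_inl (a₀ a : punctured p)
    (ha : a ∈ (chartAt (EuclideanSpace ℝ (Fin 4)) a₀).source) :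
    inTangentCoordinates (𝓡 4) (𝓡 4) (id : (capGlueData hε' hball).Glued → (capGlueData hε' hball).Glued)
        id (capJ hε' hball J) ((capGlueData hε' hball).inl a₀) ((capGlueData hε' hball).inl a) =
      inTangentCoordinates (𝓡 4) (𝓡 4) (id : punctured p → punctured p) id (fun x => J x) a₀ a := by
  have hsrc : (capGlueData hε' hball).inl a ∈
      (chartAt (EuclideanSpace ℝ (Fin 4)) ((capGlueData hε' hball).inl a₀)).source := by
    rw [chartAt_inl, SmoothGlueData.chartA_source]
    exact mem_image_of_mem _ ha
  rw [inTangentCoordinates_eq (id : (capGlueData hε' hball).Glued → (capGlueData hε' hball).Glued) id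
      (capJ hε' hball J) (x₀ := (capGlueData hε' hball).inl a₀) (x := (capGlueData hε' hball).inl a)
      hsrc hsrc,
    inTangentCoordinates_eq (id : punctured p → punctured p) id (fun x => J x) (x₀ := a₀) (x := a) ha ha]
  simp only [id_eq, tangentBundleCore_coordChange_achart]
  -- the chart transitions of `X` between `inl a`, `inl a₀` ARE those of `Σ ∖ p` between `a`, `a₀`
  have hf : ((extChartAt (𝓡 4) ((capGlueData hε' hball).inl a₀)) ∘
      (extChartAt (𝓡 4) ((capGlueData hε' hball).inl a)).symm) =
      ((extChartAt (𝓡 4) a₀) ∘ (extChartAt (𝓡 4) a).symm) := by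
    funext v
    rw [comp_apply, comp_apply, extChartAt_inl_symm_apply, extChartAt_inl_apply]
  have hg : ((extChartAt (𝓡 4) ((capGlueData hε' hball).inl a)) ∘
      (extChartAt (𝓡 4) ((capGlueData hε' hball).inl a₀)).symm) =
      ((extChartAt (𝓡 4) a) ∘ (extChartAt (𝓡 4) a₀).symm) := by
    funext v
    rw [comp_apply, comp_apply, extChartAt_inl_symm_apply, extChartAt_inl_apply]
  rw [hf, hg, extChartAt_inl_apply, extChartAt_inl_apply, capJ_inl]

include hJsmooth in
/-- `capJ` is smooth, as a section of `End(TX)`, at the points of `Σ ∖ p`. -/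
theorem contMDiffAt_inTangentCoordinates_capJ_inl (a₀ : punctured p) :
    ContMDiffAt (𝓡 4) 𝓘(ℝ, EuclideanSpace ℝ (Fin 4) →L[ℝ] EuclideanSpace ℝ (Fin 4)) ∞
      (inTangentCoordinates (𝓡 4) (𝓡 4)
        (id : (capGlueData hε' hball).Glued → (capGlueData hε' hball).Glued) id (capJ hε' hball J)
        ((capGlueData hε' hball).inl a₀)) ((capGlueData hε' hball).inl a₀) := by
  set d := capGlueData hε' hball
  rw [SmoothGlueData.contMDiffAt_inl_iff]
  refine (hJsmooth a₀).congr_of_eventuallyEq ?_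
  filter_upwards [(chartAt (EuclideanSpace ℝ (Fin 4)) a₀).open_source.mem_nhds
    (mem_chart_source _ a₀)] with a ha
  exact inTangentCoordinates_capJ_inl hε' hball J a₀ a ha

/-- On `range inr`, the extended chart at a point of the added line is `flatCx.symm ∘ capCoordMap`. -/
theorem extChartAt_inr_eq {b₀ : capDisc (capRadius ε')}
    (hb₀ : (capGlueData hε' hball).inr b₀ ∉ range (capGlueData hε' hball).inl)
    {y : (capGlueData hε' hball).Glued} (hy : y ∈ range (capGlueData hε' hball).inr) :
    extChartAt (𝓡 4) ((capGlueData hε' hball).inr b₀) y = flatCx.symm (capCoordMap hε' hball y) := by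
  obtain ⟨b, rfl⟩ := hy
  rw [extChartAt_inr_apply hε' hball hb₀, capCoordMap_inr]

/-- The differential of that extended chart: `flatCx.symm ∘ d(capCoordMap)`. -/
theorem hasMFDerivAt_extChartAt_inr {b₀ : capDisc (capRadius ε')}
    (hb₀ : (capGlueData hε' hball).inr b₀ ∉ range (capGlueData hε' hball).inl)
    {q : ℂ × ℂ} (hq : ‖q.1‖ < capRadius ε') :
    HasMFDerivAt (𝓡 4) 𝓘(ℝ, EuclideanSpace ℝ (Fin 4))
      (extChartAt (𝓡 4) ((capGlueData hε' hball).inr b₀)) (capInvMap hε' hball q)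
      ((flatCx.symm : ℂ × ℂ →L[ℝ] EuclideanSpace ℝ (Fin 4)).comp
        (mfderiv (𝓡 4) 𝓘(ℝ, ℂ × ℂ) (capCoordMap hε' hball) (capInvMap hε' hball q))) := by
  set d := capGlueData hε' hball
  have h1 : HasMFDerivAt (𝓡 4) 𝓘(ℝ, ℂ × ℂ) (capCoordMap hε' hball) (capInvMap hε' hball q)
      (mfderiv (𝓡 4) 𝓘(ℝ, ℂ × ℂ) (capCoordMap hε' hball) (capInvMap hε' hball q)) :=
    ((contMDiffAt_capCoordMap hε' hball hq).mdifferentiableAt (by simp)).hasMFDerivAt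
  have h2 : HasMFDerivAt 𝓘(ℝ, ℂ × ℂ) 𝓘(ℝ, EuclideanSpace ℝ (Fin 4))
      (flatCx.symm : ℂ × ℂ → EuclideanSpace ℝ (Fin 4))
      (capCoordMap hε' hball (capInvMap hε' hball q))
      (flatCx.symm : ℂ × ℂ →L[ℝ] EuclideanSpace ℝ (Fin 4)) :=
    hasMFDerivAt_iff_hasFDerivAt.2
      (flatCx.symm : ℂ × ℂ →L[ℝ] EuclideanSpace ℝ (Fin 4)).hasFDerivAt
  refine (h2.comp _ h1).congr_of_eventuallyEq ?_
  filter_upwards [(isOpen_capInvMap_image hε' hball).mem_nhds ⟨q, hq, rfl⟩] with y hy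
  rw [capInvMap_image] at hy
  exact extChartAt_inr_eq hε' hball hb₀ hy

include hJstd in
/-- **At points of the cap chart domain, seen from a point of the added line, the
tangent-coordinate expression of `capJ` is the constant `flatI`.** -/
theorem inTangentCoordinates_capJ_inr {b₀ : capDisc (capRadius ε')}
    (hb₀ : (capGlueData hε' hball).inr b₀ ∉ range (capGlueData hε' hball).inl)
    {q : ℂ × ℂ} (hq : ‖q.1‖ < capRadius ε') :
    inTangentCoordinates (𝓡 4) (𝓡 4) (id : (capGlueData hε' hball).Glued → (capGlueData hε' hball).Glued)
        id (capJ hε' hball J) ((capGlueData hε' hball).inr b₀) (capInvMap hε' hball q) = flatI := by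
  set d := capGlueData hε' hball
  set y₀ := d.inr b₀
  set y := capInvMap hε' hball q
  have hy_src : y ∈ (chartAt (EuclideanSpace ℝ (Fin 4)) y₀).source := by
    rw [← extChartAt_source (I := 𝓡 4), extChartAt_inr_source hε' hball hb₀, ← capInvMap_image]
    exact ⟨q, hq, rfl⟩
  have hy_ext : y ∈ (extChartAt (𝓡 4) y₀).source := by rwa [extChartAt_source]
  rw [inTangentCoordinates_eq_mfderiv_comp (f := (id : d.Glued → d.Glued)) (g := (id : d.Glued → d.Glued))
    (ϕ := capJ hε' hball J) (x₀ := y₀) (x := y) hy_src hy_src]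
  simp only [id_eq]
  -- notation
  set A := mfderiv (𝓡 4) 𝓘(ℝ, EuclideanSpace ℝ (Fin 4)) (extChartAt (𝓡 4) y₀) y with hA
  set B := mfderivWithin 𝓘(ℝ, EuclideanSpace ℝ (Fin 4)) (𝓡 4) (extChartAt (𝓡 4) y₀).symm
    (range (𝓡 4)) (extChartAt (𝓡 4) y₀ y) with hB
  set P := mfderiv (𝓡 4) 𝓘(ℝ, ℂ × ℂ) (capCoordMap hε' hball) y
  set Q := mfderiv 𝓘(ℝ, ℂ × ℂ) (𝓡 4) (capInvMap hε' hball) q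
  have hAeq : A = (flatCx.symm : ℂ × ℂ →L[ℝ] EuclideanSpace ℝ (Fin 4)).comp P :=
    (hasMFDerivAt_extChartAt_inr hε' hball hb₀ hq).mfderiv
  have hPQ : P.comp Q = ContinuousLinearMap.id ℝ (ℂ × ℂ) := mfderiv_capCoordMap_comp hε' hball hq
  have hBA : B.comp A = ContinuousLinearMap.id _ _ :=
    mfderivWithin_extChartAt_symm_comp_mfderiv_extChartAt' hy_ext
  -- `C := Q ∘ flatCx` is a right inverse of `A`, hence equals the inverse `B` (pointwise)
  set C := Q.comp (flatCx : EuclideanSpace ℝ (Fin 4) →L[ℝ] ℂ × ℂ)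
  have hPQv : ∀ w : ℂ × ℂ, P (Q w) = w := fun w =>
    congrArg (fun L : ℂ × ℂ →L[ℝ] ℂ × ℂ => L w) hPQ
  have hACw : ∀ w : EuclideanSpace ℝ (Fin 4), A (C w) = w := by
    intro w
    rw [hAeq]
    show flatCx.symm (P (Q (flatCx w))) = w
    rw [hPQv, ContinuousLinearEquiv.symm_apply_apply]
  have hBAw : ∀ u : EuclideanSpace ℝ (Fin 4), B (A u) = u := fun u =>
    congrArg (fun L => L u) hBA
  have hBCw : ∀ w : EuclideanSpace ℝ (Fin 4), B w = C w := by
    intro w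
    have h1 : B w = B (A (C w)) := by rw [hACw]
    exact h1.trans (hBAw (C w))
  refine DFunLike.ext _ _ fun v => ?_
  show A (capJ hε' hball J y (B v)) = flatI v
  rw [hBCw, hAeq]
  have hJ := capJ_capInvMap hε' hball J hJstd hq (flatCx v)
  show flatCx.symm (P (capJ hε' hball J y (Q (flatCx v)))) = flatI v
  rw [show capJ hε' hball J y (Q (flatCx v)) = Q (Complex.I • flatCx v) from hJ, hPQv,
    ← flatCx_flatI, ContinuousLinearEquiv.symm_apply_apply]

include hJstd in
/-- `capJ` is smooth, as a section of `End(TX)`, at the points of the added line. -/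
theorem contMDiffAt_inTangentCoordinates_capJ_inr {b₀ : capDisc (capRadius ε')}
    (hb₀ : (capGlueData hε' hball).inr b₀ ∉ range (capGlueData hε' hball).inl) :
    ContMDiffAt (𝓡 4) 𝓘(ℝ, EuclideanSpace ℝ (Fin 4) →L[ℝ] EuclideanSpace ℝ (Fin 4)) ∞
      (inTangentCoordinates (𝓡 4) (𝓡 4)
        (id : (capGlueData hε' hball).Glued → (capGlueData hε' hball).Glued) id (capJ hε' hball J)
        ((capGlueData hε' hball).inr b₀)) ((capGlueData hε' hball).inr b₀) := by
  refine (contMDiffAt_const (c := flatI)).congr_of_eventuallyEq ?_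
  filter_upwards [(isOpen_capInvMap_image hε' hball).mem_nhds
    ⟨(b₀ : ℂ × ℂ), b₀.2, by rw [capInvMap_of_lt hε' hball b₀.2]⟩] with y hy
  obtain ⟨q, hq, rfl⟩ := hy
  exact inTangentCoordinates_capJ_inr hε' hball J hJstd hb₀ hq

include hJ2 hJstd hJsmooth in
/-- **The almost complex structure of the cap.** -/
theorem exists_capJX :
    ∃ JX : AlmostComplexStructure (𝓡 4) ∞ (capGlueData hε' hball).Glued,
      ∀ y, JX y = capJ hε' hball J y := by
  set d := capGlueData hε' hball
  refine ⟨⟨capJ hε' hball J, capJ_capJ hε' hball J hJ2, ?_⟩, fun y => rfl⟩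
  intro y₀
  rw [contMDiffAt_hom_bundle]
  refine ⟨contMDiffAt_id, ?_⟩
  change ContMDiffAt (𝓡 4) 𝓘(ℝ, EuclideanSpace ℝ (Fin 4) →L[ℝ] EuclideanSpace ℝ (Fin 4)) ∞
    (inTangentCoordinates (𝓡 4) (𝓡 4) (id : d.Glued → d.Glued) id (capJ hε' hball J) y₀) y₀
  obtain (⟨a₀, rfl⟩ | ⟨b₀, rfl⟩) := d.exists_inl_or_inr y₀
  · exact contMDiffAt_inTangentCoordinates_capJ_inl hε' hball J hJsmooth a₀
  · by_cases hb₀ : d.inr b₀ ∈ range d.inl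
    · obtain ⟨a₀, ha₀⟩ := hb₀
      rw [← ha₀]
      exact contMDiffAt_inTangentCoordinates_capJ_inl hε' hball J hJsmooth a₀
    · exact contMDiffAt_inTangentCoordinates_capJ_inr hε' hball J hJstd hb₀

end Summit.SmoothPoincare4.SmoothPoincare4.Theorems.WitnessCharge.PencilIncompleteness
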